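import Literature.AlgebraicGeometry.Resolution.QuadraticTransforms
import Literature.RingTheory.RegularLocalRing.QuotientDVR
import Mathlib.RingTheory.Valuation.ValuationRing
import HarnessLib

/-!
# A regular local ring of dimension `≤ 1` dominated by a valuation ring is the valuation ring
# (crux `IndSmooth.ValuativeSmoothing`, line `birth`, stub `stub_eqOfDominatesOfDimLeOne`)

Stub `stub_eqOfDominatesOfDimLeOne` of the skeleton `Lines/birth.lean` (lead reshape r5,
family 4: "regular centre of dimension `≤ 2` on some affine model") for crux
stmt-ResolutionOfSingularities-16087. Let `K` be a field, `O` a valuation ring of `K` and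
`R₀ ⊆ K` a regular local ring of Krull dimension `≤ 1` with quotient field `K`
(`IsLocalRingOf R₀`) which is dominated by `O` (`SubringDominates R₀ O`: `R₀ ≤ O` and an element
of `R₀` invertible in `O` is invertible in `R₀`). Then `O = R₀`.

Proof. A regular local ring of dimension `≤ 1` is a principal ideal ring
(`isPrincipalIdealRing_of_ringKrullDim_le_one`), hence local Bézout, hence a valuation ring
(Mathlib: `IsLocalRing` + `IsBezout` ⇒ `ValuationRing`). For `z ∈ O` write `z = a / b` with
`a, b ∈ R₀`, `b ≠ 0`; in the valuation ring `R₀` either `b ∣ a`, so `z ∈ R₀`, or `a ∣ b`, say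
`b = a c`, so `z = c⁻¹` with `c ∈ R₀` invertible in `O`, whence `z = c⁻¹ ∈ R₀` by domination.
-/

-- single-problem summit: the doubled namespace component is forced
set_option linter.dupNamespace false

namespace Summit.ResolutionOfSingularities.ResolutionOfSingularities.Theorems.ValuativeSmoothing

open IsLocalRing Literature.AlgebraicGeometry.Resolution

/-- **Stub `stub_eqOfDominatesOfDimLeOne` (line `birth`, crux `IndSmooth.ValuativeSmoothing`;
r5-S4).** A regular local ring `R₀` of `K` (`Frac R₀ = K`) of dimension `≤ 1` is a principal
ideal ring (a field or a discrete valuation ring), hence a valuation ring of `K`, and a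
valuation ring of `K` dominated by the valuation ring `O` equals it: for `z = a / b ∈ O`
(`a, b ∈ R₀`) either `b ∣ a` in `R₀`, so `z ∈ R₀`, or `b = a c`, so `z = c⁻¹` with `c ∈ R₀` a
unit of `O`, hence `z ∈ R₀` by domination. [folklore] -/
theorem stub_eqOfDominatesOfDimLeOne {K : Type} [Field K] (O : ValuationSubring K)
    (R₀ : Subring K) (hreg : IsRegularLocalRing R₀) (hdim : ringKrullDim R₀ ≤ 1)
    (hof : IsLocalRingOf R₀) (hdom : SubringDominates R₀ O.toSubring) : O.toSubring = R₀ := by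
  haveI := hreg
  haveI : IsPrincipalIdealRing R₀ := isPrincipalIdealRing_of_ringKrullDim_le_one hdim
  -- local + Bézout (+ domain) ⇒ valuation ring
  haveI : ValuationRing R₀ := inferInstance
  refine le_antisymm ?_ hdom.1
  intro z hz
  obtain ⟨a, ha, b, hb, hb0, rfl⟩ := hof.2 z
  obtain ⟨c, hc | hc⟩ := ValuationRing.cond (⟨a, ha⟩ : R₀) ⟨b, hb⟩
  · -- `a * c = b`: `z = a / (a * c) = c⁻¹`, and `c ∈ R₀` is invertible in `O`
    have hc' : a * (c : K) = b := congrArg Subtype.val hc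
    have ha0 : a ≠ 0 := by
      rintro rfl
      exact hb0 (by rw [← hc', zero_mul])
    have hz' : a / b = (c : K)⁻¹ := by rw [← hc', div_mul_cancel_left₀ ha0]
    rw [hz'] at hz ⊢
    exact hdom.2 (c : K) c.2 hz
  · -- `b * c = a`: `z = c ∈ R₀`
    have hc' : b * (c : K) = a := congrArg Subtype.val hc
    rw [← hc', mul_div_cancel_left₀ _ hb0]
    exact c.2

end Summit.ResolutionOfSingularities.ResolutionOfSingularities.Theorems.ValuativeSmoothing
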